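import Summits.Ventures.PackingBounds.Configurations.SixHundredCellCodeDesign
import Summits.Ventures.PackingBounds.Energy.ChebyshevUExplicit

/-!
# `120`-point codes of angle `36°` in `ℝ⁴`: every point has exactly twelve neighbours at `36°`

Framing: lottery ticket; floor = certified bounds/negative ranges. Venture `PackingBounds` (cell
`pub-packcert`, seat `pub-packcert-energy`) — uniqueness of the 600-cell, step 2 (after
`SixHundredCellCodeDesign`).

For a `120`-point code `C ⊂ S³` with pairwise inner products `≤ t = (1+√5)/4`, the number of points of `C`
at inner product exactly `t` from a given `x ∈ C` is `12` (`card_nbr_eq_twelve`) — the valency of the 600-cell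
graph. Proof: the Lagrange polynomial `L` of degree `7` that is `1` at `t` and `0` at the seven other
admissible inner products (`SixHundredCellCodeDesign.inner_mem_of_card_eq_120`), written in the Chebyshev basis
`L = Σ_{j ≤ 7} q_j U_j` with `q_j ∈ ℚ(√5)` (`lagP`), has `Σ_{w ∈ C} L(⟪x, w⟫) = 120 q_0 = 30 - 6√5` by the
design property (moments `1…7` vanish around `x`), and also `= L(1) + #N_t(x) = 18 - 6√5 + #N_t(x)`.

## References
* P. Boyvalenkov, D. Danev, *Uniqueness of the 120-point spherical 11-design in four dimensions*,
  Arch. Math. 77 (2001) 360–368.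
* H. Cohn, A. Kumar, J. Amer. Math. Soc. 20 (2007) 99–148, Table 1. [`CohnKumar2006`]
-/

noncomputable section

namespace Summit.Ventures.PackingBounds.Config.SixHundredCellCode

open Finset Literature.Analysis.SpecialFunctions Literature.Geometry.DiscreteGeometry
open Summit.Ventures.PackingBounds.Energy.ChebyshevU

/-- The Lagrange indicator of `(1+√5)/4` on the eight admissible inner products, in the basis `U_j = C_j^{(1)}`. -/
def lagP (u : ℝ) : ℝ :=
  (((1 : ℝ) / 4) + ((-1 : ℝ) / 20) * Real.sqrt 5) * gegenbauerSum (1 : ℝ) 0 u +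
  (((7 : ℝ) / 20) + ((-1 : ℝ) / 20) * Real.sqrt 5) * gegenbauerSum (1 : ℝ) 1 u +
  (((1 : ℝ) / 2) + ((-1 : ℝ) / 10) * Real.sqrt 5) * gegenbauerSum (1 : ℝ) 2 u +
  (((7 : ℝ) / 10) + ((-1 : ℝ) / 5) * Real.sqrt 5) * gegenbauerSum (1 : ℝ) 3 u +
  (((3 : ℝ) / 4) + ((-1 : ℝ) / 4) * Real.sqrt 5) * gegenbauerSum (1 : ℝ) 4 u +
  (((9 : ℝ) / 20) + ((-3 : ℝ) / 20) * Real.sqrt 5) * gegenbauerSum (1 : ℝ) 5 u +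
  (((1 : ℝ) / 2) + ((-1 : ℝ) / 5) * Real.sqrt 5) * gegenbauerSum (1 : ℝ) 6 u +
  (((7 : ℝ) / 20) + ((-3 : ℝ) / 20) * Real.sqrt 5) * gegenbauerSum (1 : ℝ) 7 u

/-- `L(t) = 1`. -/
theorem lagP_t : lagP ((1 + Real.sqrt 5) / 4) = 1 := by
  have hX := sqrt5_facts.1
  simp only [lagP, c1_0, c1_1, c1_2, c1_3, c1_4, c1_5, c1_6, c1_7]
  linear_combination (((557 : ℝ) / 2560) + ((-99 : ℝ) / 1280) * Real.sqrt 5 + ((83 : ℝ) / 2560) * Real.sqrt 5 ^ 2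
    + ((11 : ℝ) / 128) * Real.sqrt 5 ^ 3 + ((3 : ℝ) / 2560) * Real.sqrt 5 ^ 4 + ((-11 : ℝ) / 1280) * Real.sqrt 5 ^ 5
    + ((-3 : ℝ) / 2560) * Real.sqrt 5 ^ 6) * hX

/-- `L(1/2) = 0`. -/
theorem lagP_half : lagP (1 / 2) = 0 := by
  simp only [lagP, c1_0, c1_1, c1_2, c1_3, c1_4, c1_5, c1_6, c1_7]
  ring

/-- `L((√5-1)/4) = 0`. -/
theorem lagP_v3 : lagP ((Real.sqrt 5 - 1) / 4) = 0 := by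
  have hX := sqrt5_facts.1
  simp only [lagP, c1_0, c1_1, c1_2, c1_3, c1_4, c1_5, c1_6, c1_7]
  linear_combination (((-261 : ℝ) / 2560) + ((9 : ℝ) / 128) * Real.sqrt 5 + ((263 : ℝ) / 2560) * Real.sqrt 5 ^ 2
    + ((-5 : ℝ) / 64) * Real.sqrt 5 ^ 3 + ((1 : ℝ) / 2560) * Real.sqrt 5 ^ 4 + ((1 : ℝ) / 128) * Real.sqrt 5 ^ 5
    + ((-3 : ℝ) / 2560) * Real.sqrt 5 ^ 6) * hX

/-- `L(0) = 0`. -/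
theorem lagP_zero : lagP 0 = 0 := by
  simp only [lagP, c1_0, c1_1, c1_2, c1_3, c1_4, c1_5, c1_6, c1_7]
  ring

/-- `L((1-√5)/4) = 0`. -/
theorem lagP_v5 : lagP ((1 - Real.sqrt 5) / 4) = 0 := by
  have hX := sqrt5_facts.1
  simp only [lagP, c1_0, c1_1, c1_2, c1_3, c1_4, c1_5, c1_6, c1_7]
  linear_combination (((9 : ℝ) / 512) + ((39 : ℝ) / 640) * Real.sqrt 5 + ((-183 : ℝ) / 2560) * Real.sqrt 5 ^ 2
    + ((-3 : ℝ) / 64) * Real.sqrt 5 ^ 3 + ((27 : ℝ) / 512) * Real.sqrt 5 ^ 4 + ((-9 : ℝ) / 640) * Real.sqrt 5 ^ 5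
    + ((3 : ℝ) / 2560) * Real.sqrt 5 ^ 6) * hX

/-- `L(-1/2) = 0`. -/
theorem lagP_neg_half : lagP (-1 / 2) = 0 := by
  simp only [lagP, c1_0, c1_1, c1_2, c1_3, c1_4, c1_5, c1_6, c1_7]
  ring

/-- `L(-(1+√5)/4) = 0`. -/
theorem lagP_v7 : lagP (-(1 + Real.sqrt 5) / 4) = 0 := by
  have hX := sqrt5_facts.1
  simp only [lagP, c1_0, c1_1, c1_2, c1_3, c1_4, c1_5, c1_6, c1_7]
  linear_combination (((-261 : ℝ) / 2560) + ((27 : ℝ) / 1280) * Real.sqrt 5 + ((317 : ℝ) / 2560) * Real.sqrt 5 ^ 2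
    + ((-3 : ℝ) / 128) * Real.sqrt 5 ^ 3 + ((-59 : ℝ) / 2560) * Real.sqrt 5 ^ 4 + ((3 : ℝ) / 1280) * Real.sqrt 5 ^ 5
    + ((3 : ℝ) / 2560) * Real.sqrt 5 ^ 6) * hX

/-- `L(-1) = 0`. -/
theorem lagP_neg_one : lagP (-1) = 0 := by
  simp only [lagP, c1_0, c1_1, c1_2, c1_3, c1_4, c1_5, c1_6, c1_7]
  ring

/-- `L(1) = 18 - 6√5`. -/
theorem lagP_one : lagP 1 = 18 - 6 * Real.sqrt 5 := by
  simp only [lagP, c1_0, c1_1, c1_2, c1_3, c1_4, c1_5, c1_6, c1_7]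
  ring

section config

variable {C : Finset (EuclideanSpace ℝ (Fin 4))} (h1 : ∀ x ∈ C, ‖x‖ = 1)
  (h2 : ∀ x ∈ C, ∀ y ∈ C, x ≠ y → inner ℝ x y ≤ (1 + Real.sqrt 5) / 4) (hN : C.card = 120)
include h1 h2 hN

/-- `Σ_{w ∈ C} L(⟪x, w⟫) = 120 q_0 = 30 - 6√5` by the design property. -/
theorem sum_lagP {x : EuclideanSpace ℝ (Fin 4)} (hx : x ∈ C) :
    ∑ w ∈ C, lagP (inner ℝ x w) = 30 - 6 * Real.sqrt 5 := by
  have m1 := pointMoment_eq_zero h1 h2 hN (k := 1) (by norm_num) (by norm_num) hx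
  have m2 := pointMoment_eq_zero h1 h2 hN (k := 2) (by norm_num) (by norm_num) hx
  have m3 := pointMoment_eq_zero h1 h2 hN (k := 3) (by norm_num) (by norm_num) hx
  have m4 := pointMoment_eq_zero h1 h2 hN (k := 4) (by norm_num) (by norm_num) hx
  have m5 := pointMoment_eq_zero h1 h2 hN (k := 5) (by norm_num) (by norm_num) hx
  have m6 := pointMoment_eq_zero h1 h2 hN (k := 6) (by norm_num) (by norm_num) hx
  have m7 := pointMoment_eq_zero h1 h2 hN (k := 7) (by norm_num) (by norm_num) hx
  simp only [lagP, Finset.sum_add_distrib, ← Finset.mul_sum, m1, m2, m3, m4, m5, m6, m7, gegenbauerSum_zero,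
    sum_const, hN]
  norm_num
  ring

/-- The value of `L` at the inner product of two DISTINCT points of the code: `1` on the neighbours at `36°`,
`0` otherwise. -/
theorem lagP_inner {x w : EuclideanSpace ℝ (Fin 4)} (hx : x ∈ C) (hw : w ∈ C) (hxw : x ≠ w) :
    lagP (inner ℝ x w) = if inner ℝ x w = (1 + Real.sqrt 5) / 4 then 1 else 0 := by
  obtain ⟨hX, hlo, hhi⟩ := sqrt5_facts
  rcases inner_mem_of_card_eq_120 h1 h2 hN hx hw hxw with h | h | h | h | h | h | h | h
  · rw [if_pos h, h, lagP_t]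
  all_goals rw [h, if_neg (by nlinarith [hlo, hhi])]
  · exact lagP_half
  · exact lagP_v3
  · exact lagP_zero
  · exact lagP_v5
  · exact lagP_neg_half
  · exact lagP_v7
  · exact lagP_neg_one

/-- **Every point of a `120`-point code of angle `36°` in `ℝ⁴` has exactly `12` points of the code at `36°`.**
[cite: CohnKumar2006, Table 1] -/
theorem card_nbr_eq_twelve {x : EuclideanSpace ℝ (Fin 4)} (hx : x ∈ C) :
    ((C.erase x).filter fun w => inner ℝ x w = (1 + Real.sqrt 5) / 4).card = 12 := by
  classical
  obtain ⟨hX, hlo, hhi⟩ := sqrt5_facts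
  have htot := sum_lagP h1 h2 hN hx
  rw [← Finset.add_sum_erase C _ hx, real_inner_self_eq_norm_sq, h1 x hx, one_pow, lagP_one] at htot
  have hrest : ∑ w ∈ C.erase x, lagP (inner ℝ x w) =
      (((C.erase x).filter fun w => inner ℝ x w = (1 + Real.sqrt 5) / 4).card : ℝ) := by
    rw [Finset.sum_congr rfl (fun w hw => lagP_inner h1 h2 hN hx (Finset.mem_of_mem_erase hw)
      (Finset.ne_of_mem_erase hw).symm), Finset.sum_ite, sum_const, sum_const, nsmul_eq_mul, smul_zero, add_zero,
      mul_one]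
  rw [hrest] at htot
  have h12 : (((C.erase x).filter fun w => inner ℝ x w = (1 + Real.sqrt 5) / 4).card : ℝ) = ((12 : ℕ) : ℝ) := by
    push_cast; linarith
  exact Nat.cast_injective h12

end config

end Summit.Ventures.PackingBounds.Config.SixHundredCellCode

end
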